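import Summits.Ventures.HSemireg.WedgeHankelRecurrenceKharitonovVertex

/-!
# Venture HSemireg — **KHARITONOV'S THEOREM (1978), every degree `n ≥ 3`: an interval family of real polynomials `p(s) = h(s²) + s·g(s²)` with the coefficients of `h` and `g` ranging
# independently over boxes `[l_k, u_k]` (top coefficient box positive) consists of Hurwitz polynomials iff the FOUR KHARITONOV POLYNOMIALS — the pairs (lower ∕ upper envelope of `h`,
# lower ∕ upper envelope of `g`), envelopes taken on `(−∞, 0]`, i.e. coefficients chosen alternately `l, u` by parity — are Hurwitz**; with the ENVELOPE form (arbitrary envelopes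
# `h_m ≤ h ≤ h_M`, `g_m ≤ g ≤ g_M` on `(−∞, 0]`)

HONEST FRAMING. Part of the Lean index of the computation cell `pub-hsemireg` (seat p10 gen 41, Sunday typer «UNIFORM-IN-n»).
REAL POLYNOMIALS ONLY (N255's vertex lemmas): no variety, no cohomology theory, no sheaf, no Ext group and no semiregularity map is constructed here; nothing here says that HC / HC_CM / HC_AV
holds; no Literature fact (unproved `Prop`) is declared or used.  Custodian versions as in `WedgeHankelSiegelIdeal` (1/3).
SOURCES (cited).  V. L. Kharitonov, *Asymptotic stability of an equilibrium position of a family of systems of linear differential equations*, Differ. Uravn. 14 (1978) 2086–2088: «the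
family `{p(s) = Σ a_k s^k : a_k ∈ [l_k, u_k]}` is stable iff the four polynomials `K_1 = l_0 + l_1 s + u_2 s² + u_3 s³ + l_4 s⁴ + ⋯`, `K_2 = u_0 + u_1 s + l_2 s² + l_3 s³ + ⋯`,
`K_3 = l_0 + u_1 s + u_2 s² + l_3 s³ + ⋯`, `K_4 = u_0 + l_1 s + l_2 s² + u_3 s³ + ⋯` are stable»; R. J. Minnichelli, J. J. Anagnost, C. A. Desoer, IEEE TAC 34 (1989) 995–998 (the Hermite–Biehler
proof); S. P. Bhattacharyya, H. Chapellat, L. H. Keel, *Robust Control: The Parametric Approach* (1995), Thm 5.1.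
PROOF TYPED HERE.  With `p(s) = h(s²) + s g(s²)` (`h_k = a_{2k}`, `g_k = a_{2k+1}` — this lineage's dictionary `coeff_even_eq ∕ coeff_odd_eq`, N213), for `x ≤ 0` every member satisfies
`h⁻(x) ≤ h(x) ≤ h⁺(x)` and `g⁻(x) ≤ g(x) ≤ g⁺(x)`, where `h⁻` takes `l` at even and `u` at odd powers of `x`, `h⁺` the reverse (`envelope_eval_le`); the four Kharitonov polynomials are
`(h⁻, g⁻) = K_1`, `(h⁺, g⁺) = K_2`, `(h⁻, g⁺) = K_3`, `(h⁺, g⁻) = K_4`; N255's vertex lemmas move first `g` (with `h = h^∓` fixed) and then `h`.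
DICTIONARY.  Boxes `lh uh : ℕ → ℝ` for the coefficients of `h` (indices `≤ deg h`), `lg ug` for `g`; the envelope with lower values at even indices is
`∑ k ∈ range (d+1), C (if Even k then l k else u k) · X^k`; even degree `n = 2m + 4`: `deg h = m + 2`, `deg g ≤ m + 1`, `0 < lh (m+2)`; odd degree `n = 2m + 3`: `deg h ≤ m + 1`,
`deg g = m + 1`, `0 < lg (m+1)`.
DEDUP DISCLOSURE (`rg -n 'Kharitonov' Summits Literature`, 2026-09-02): N227 (degrees 2, 3 explicitly); nothing in general degree.  The 11 names below: 0 hits tree-wide.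

WHAT IS IN THE TREE.  N255 `forall_re_neg_of_between_odd_part_of_even`, `…_even_part_of_odd`, `…_even_part_of_even`, `…_odd_part_of_odd`; Mathlib `Polynomial.eval_eq_sum_range'`,
`finsetSum_coeff`, `coeff_C_mul_X_pow`, `Even.pow_nonneg`, `Odd.pow_nonpos`.
THIS FILE (namespace `Summit.Ventures.HSemireg.Wedge.HankelOuter` continued; CHAINED on N255; 0 definitions):
* §1019 ENVELOPE FORM: **`kharitonov_envelope_of_even`** (degree `2m + 4`), **`kharitonov_envelope_of_odd`** (degree `2m + 3`).
* §1020 THE KHARITONOV ENVELOPES OF A BOX: `coeff_sum_C_mul_X_pow`, `eval_sum_C_mul_X_pow`, `natDegree_sum_C_mul_X_pow_le`, `natDegree_sum_C_mul_X_pow`, `leadingCoeff_sum_C_mul_X_pow`,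
  **`envelope_eval_le`** (`x ≤ 0`, coefficients in the box ⇒ lower envelope `≤ h(x) ≤` upper envelope), `envelope_mem_box` (the envelopes are members).
* §1021 **KHARITONOV'S THEOREM**: **`kharitonov_of_even`** (degree `2m + 4 ≥ 4`: all members Hurwitz ⟺ the four Kharitonov pairs Hurwitz), **`kharitonov_of_odd`** (degree `2m + 3 ≥ 3`).
CAVEATS.  Degrees `1, 2` are not restated (degree `2` is N227's `forall_re_neg_box_iff_of_natDegree_two`; degree `1` is trivial); the statement is in the `(h, g)` = (even part, odd part)
coordinates of this lineage, the passage to `p = Σ a_k s^k` being N213's `coeff_even_eq ∕ coeff_odd_eq`.  Nothing Ext-side.  New names only.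
-/

open Module Polynomial
open scoped Matrix Polynomial

namespace Summit.Ventures.HSemireg.Wedge.HankelOuter

/-! ## §1019. Kharitonov's theorem, envelope form -/

/-- **KHARITONOV, ENVELOPE FORM, EVEN DEGREE `2m + 4`.**  Let `h_m, h_M` have degree `m + 2` and `g_m, g_M` degree `≤ m + 1`, positive leading coefficients for `h_m, h_M`, and suppose the four
pairs `(h_m, g_m)`, `(h_m, g_M)`, `(h_M, g_m)`, `(h_M, g_M)` are Hurwitz.  Then every `(h, g)` with `deg h = m + 2`, `lc h > 0`, `deg g ≤ m + 1`, `h_m ≤ h ≤ h_M` and `g_m ≤ g ≤ g_M` pointwise on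
`(−∞, 0]` is Hurwitz. [Kharitonov 1978; Minnichelli–Anagnost–Desoer 1989; this file, §1019] -/
theorem kharitonov_envelope_of_even (m : ℕ) {hm hM gm gM : ℝ[X]} (hhm : hm.natDegree = m + 2) (hmlc : 0 < hm.leadingCoeff) (hhM : hM.natDegree = m + 2) (hMlc : 0 < hM.leadingCoeff)
    (hgm : gm.natDegree ≤ m + 1) (hgM : gM.natDegree ≤ m + 1)
    (K1 : ∀ z ∈ ((expand ℝ 2 hm + Polynomial.X * expand ℝ 2 gm).map (algebraMap ℝ ℂ)).roots, z.re < 0)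
    (K3 : ∀ z ∈ ((expand ℝ 2 hm + Polynomial.X * expand ℝ 2 gM).map (algebraMap ℝ ℂ)).roots, z.re < 0)
    (K4 : ∀ z ∈ ((expand ℝ 2 hM + Polynomial.X * expand ℝ 2 gm).map (algebraMap ℝ ℂ)).roots, z.re < 0)
    (K2 : ∀ z ∈ ((expand ℝ 2 hM + Polynomial.X * expand ℝ 2 gM).map (algebraMap ℝ ℂ)).roots, z.re < 0)
    {h g : ℝ[X]} (hh : h.natDegree = m + 2) (hlc : 0 < h.leadingCoeff) (hg : g.natDegree ≤ m + 1)
    (hbh : ∀ x : ℝ, x ≤ 0 → hm.eval x ≤ h.eval x ∧ h.eval x ≤ hM.eval x) (hbg : ∀ x : ℝ, x ≤ 0 → gm.eval x ≤ g.eval x ∧ g.eval x ≤ gM.eval x) :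
    ∀ z ∈ ((expand ℝ 2 h + Polynomial.X * expand ℝ 2 g).map (algebraMap ℝ ℂ)).roots, z.re < 0 := by
  have Hm := forall_re_neg_of_between_odd_part_of_even (m + 1) hhm hmlc hg hgm hgM K1 K3 hbg
  have HM := forall_re_neg_of_between_odd_part_of_even (m + 1) hhM hMlc hg hgm hgM K4 K2 hbg
  exact forall_re_neg_of_between_even_part_of_even m hh hlc hhm hmlc hhM hg Hm HM hbh

/-- **KHARITONOV, ENVELOPE FORM, ODD DEGREE `2m + 3`.**  Let `h_m, h_M, g_m, g_M` have degree `m + 1` with positive leading coefficients and suppose the four pairs are Hurwitz.  Then every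
`(h, g)` with `deg h ≤ m + 1`, `deg g = m + 1`, `lc g > 0`, `h_m ≤ h ≤ h_M` and `g_m ≤ g ≤ g_M` on `(−∞, 0]` is Hurwitz. [Kharitonov 1978; Minnichelli–Anagnost–Desoer 1989; this file, §1019] -/
theorem kharitonov_envelope_of_odd (m : ℕ) {hm hM gm gM : ℝ[X]} (hhm : hm.natDegree = m + 1) (hmlc : 0 < hm.leadingCoeff) (hhM : hM.natDegree = m + 1) (hMlc : 0 < hM.leadingCoeff)
    (hgm : gm.natDegree = m + 1) (hgM : gM.natDegree = m + 1)
    (K1 : ∀ z ∈ ((expand ℝ 2 hm + Polynomial.X * expand ℝ 2 gm).map (algebraMap ℝ ℂ)).roots, z.re < 0)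
    (K3 : ∀ z ∈ ((expand ℝ 2 hm + Polynomial.X * expand ℝ 2 gM).map (algebraMap ℝ ℂ)).roots, z.re < 0)
    (K4 : ∀ z ∈ ((expand ℝ 2 hM + Polynomial.X * expand ℝ 2 gm).map (algebraMap ℝ ℂ)).roots, z.re < 0)
    (K2 : ∀ z ∈ ((expand ℝ 2 hM + Polynomial.X * expand ℝ 2 gM).map (algebraMap ℝ ℂ)).roots, z.re < 0)
    {h g : ℝ[X]} (hh : h.natDegree ≤ m + 1) (hg : g.natDegree = m + 1) (hglc : 0 < g.leadingCoeff)
    (hbh : ∀ x : ℝ, x ≤ 0 → hm.eval x ≤ h.eval x ∧ h.eval x ≤ hM.eval x) (hbg : ∀ x : ℝ, x ≤ 0 → gm.eval x ≤ g.eval x ∧ g.eval x ≤ gM.eval x) :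
    ∀ z ∈ ((expand ℝ 2 h + Polynomial.X * expand ℝ 2 g).map (algebraMap ℝ ℂ)).roots, z.re < 0 := by
  have Hm := forall_re_neg_of_between_odd_part_of_odd m hhm hmlc hg hglc hgm hgM K1 K3 hbg
  have HM := forall_re_neg_of_between_odd_part_of_odd m hhM hMlc hg hglc hgm hgM K4 K2 hbg
  exact forall_re_neg_of_between_even_part_of_odd m hg hglc hh hhm.le hhM.le Hm HM hbh

/-! ## §1020. The Kharitonov envelopes of a coefficient box -/

/-- Coefficients of `Σ_{k ≤ d} c_k X^k`. [folklore; this file, §1020] -/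
theorem coeff_sum_C_mul_X_pow (c : ℕ → ℝ) (d n : ℕ) : (∑ k ∈ Finset.range (d + 1), C (c k) * X ^ k : ℝ[X]).coeff n = if n ≤ d then c n else 0 := by
  rw [finsetSum_coeff]
  simp_rw [coeff_C_mul_X_pow]
  rw [Finset.sum_ite_eq (Finset.range (d + 1)) n c]
  simp only [Finset.mem_range, Nat.lt_succ_iff]

/-- Values of `Σ_{k ≤ d} c_k X^k`. [folklore; this file, §1020] -/
theorem eval_sum_C_mul_X_pow (c : ℕ → ℝ) (d : ℕ) (x : ℝ) : (∑ k ∈ Finset.range (d + 1), C (c k) * X ^ k : ℝ[X]).eval x = ∑ k ∈ Finset.range (d + 1), c k * x ^ k := by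
  rw [eval_finsetSum]
  simp only [eval_mul, eval_C, eval_pow, eval_X]

/-- `deg (Σ_{k ≤ d} c_k X^k) ≤ d`. [folklore; this file, §1020] -/
theorem natDegree_sum_C_mul_X_pow_le (c : ℕ → ℝ) (d : ℕ) : (∑ k ∈ Finset.range (d + 1), C (c k) * X ^ k : ℝ[X]).natDegree ≤ d := by
  rw [natDegree_le_iff_coeff_eq_zero]
  intro n hn
  rw [coeff_sum_C_mul_X_pow, if_neg (by omega)]

/-- `deg (Σ_{k ≤ d} c_k X^k) = d` when `c_d ≠ 0`. [folklore; this file, §1020] -/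
theorem natDegree_sum_C_mul_X_pow {c : ℕ → ℝ} {d : ℕ} (hc : c d ≠ 0) : (∑ k ∈ Finset.range (d + 1), C (c k) * X ^ k : ℝ[X]).natDegree = d := by
  refine le_antisymm (natDegree_sum_C_mul_X_pow_le c d) (le_natDegree_of_ne_zero ?_)
  rw [coeff_sum_C_mul_X_pow, if_pos le_rfl]
  exact hc

/-- `lc (Σ_{k ≤ d} c_k X^k) = c_d` when `c_d ≠ 0`. [folklore; this file, §1020] -/
theorem leadingCoeff_sum_C_mul_X_pow {c : ℕ → ℝ} {d : ℕ} (hc : c d ≠ 0) : (∑ k ∈ Finset.range (d + 1), C (c k) * X ^ k : ℝ[X]).leadingCoeff = c d := by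
  rw [leadingCoeff, natDegree_sum_C_mul_X_pow hc, coeff_sum_C_mul_X_pow, if_pos le_rfl]

/-- **THE ENVELOPES ON `(−∞, 0]`**: if `deg h ≤ d` and `l_k ≤ h_k ≤ u_k` for `k ≤ d`, then for every `x ≤ 0`
`Σ_k (l_k if k even, u_k if k odd) x^k ≤ h(x) ≤ Σ_k (u_k if k even, l_k if k odd) x^k` (even powers of `x` are `≥ 0`, odd powers `≤ 0`).
[Kharitonov 1978 (the mechanism of the four polynomials); this file, §1020] -/
theorem envelope_eval_le {d : ℕ} {l u : ℕ → ℝ} {h : ℝ[X]} (hd : h.natDegree ≤ d) (hbox : ∀ k, k ≤ d → l k ≤ h.coeff k ∧ h.coeff k ≤ u k) {x : ℝ} (hx : x ≤ 0) :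
    (∑ k ∈ Finset.range (d + 1), C (if Even k then l k else u k) * X ^ k : ℝ[X]).eval x ≤ h.eval x
      ∧ h.eval x ≤ (∑ k ∈ Finset.range (d + 1), C (if Even k then u k else l k) * X ^ k : ℝ[X]).eval x := by
  rw [eval_sum_C_mul_X_pow, eval_sum_C_mul_X_pow, eval_eq_sum_range' (lt_of_le_of_lt hd (Nat.lt_succ_self d))]
  constructor <;> refine Finset.sum_le_sum fun k hk => ?_ <;> have hk' := hbox k (Nat.lt_succ_iff.1 (Finset.mem_range.1 hk)) <;>
    rcases Nat.even_or_odd k with he | ho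
  · rw [if_pos he]; exact mul_le_mul_of_nonneg_right hk'.1 (he.pow_nonneg x)
  · rw [if_neg (Nat.not_even_iff_odd.2 ho)]; exact mul_le_mul_of_nonpos_right hk'.2 (ho.pow_nonpos hx)
  · rw [if_pos he]; exact mul_le_mul_of_nonneg_right hk'.2 (he.pow_nonneg x)
  · rw [if_neg (Nat.not_even_iff_odd.2 ho)]; exact mul_le_mul_of_nonpos_right hk'.1 (ho.pow_nonpos hx)

/-- The two envelopes are members of the box (`l_k ≤ u_k`). [folklore; this file, §1020] -/
theorem envelope_mem_box {d : ℕ} {l u : ℕ → ℝ} (hlu : ∀ k, k ≤ d → l k ≤ u k) :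
    (∀ k, k ≤ d → l k ≤ (∑ k ∈ Finset.range (d + 1), C (if Even k then l k else u k) * X ^ k : ℝ[X]).coeff k
        ∧ (∑ k ∈ Finset.range (d + 1), C (if Even k then l k else u k) * X ^ k : ℝ[X]).coeff k ≤ u k)
      ∧ ∀ k, k ≤ d → l k ≤ (∑ k ∈ Finset.range (d + 1), C (if Even k then u k else l k) * X ^ k : ℝ[X]).coeff k
        ∧ (∑ k ∈ Finset.range (d + 1), C (if Even k then u k else l k) * X ^ k : ℝ[X]).coeff k ≤ u k := by
  constructor <;> intro k hk <;> rw [coeff_sum_C_mul_X_pow, if_pos hk] <;> split_ifs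
  · exact ⟨le_rfl, hlu k hk⟩
  · exact ⟨hlu k hk, le_rfl⟩
  · exact ⟨hlu k hk, le_rfl⟩
  · exact ⟨le_rfl, hlu k hk⟩

/-! ## §1021. Kharitonov's theorem -/

/-- **KHARITONOV'S THEOREM, EVEN DEGREE `n = 2m + 4 ≥ 4`.**  For coefficient boxes `lh_k ≤ h_k ≤ uh_k` (`k ≤ m + 2`, `0 < lh_{m+2}`) and `lg_k ≤ g_k ≤ ug_k` (`k ≤ m + 1`): EVERY
`p = h(X²) + X·g(X²)` of the family is Hurwitz iff the FOUR KHARITONOV pairs (envelopes of `h` × envelopes of `g`, coefficients alternately `l ∕ u` by parity) are Hurwitz.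
[Kharitonov 1978, Thm; Bhattacharyya–Chapellat–Keel Thm 5.1; this file, §1021] -/
theorem kharitonov_of_even (m : ℕ) {lh uh lg ug : ℕ → ℝ} (hlhu : ∀ k, k ≤ m + 2 → lh k ≤ uh k) (hlgu : ∀ k, k ≤ m + 1 → lg k ≤ ug k) (htop : 0 < lh (m + 2)) :
    (∀ h g : ℝ[X], h.natDegree ≤ m + 2 → g.natDegree ≤ m + 1 → (∀ k, k ≤ m + 2 → lh k ≤ h.coeff k ∧ h.coeff k ≤ uh k) → (∀ k, k ≤ m + 1 → lg k ≤ g.coeff k ∧ g.coeff k ≤ ug k) →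
        ∀ z ∈ ((expand ℝ 2 h + Polynomial.X * expand ℝ 2 g).map (algebraMap ℝ ℂ)).roots, z.re < 0)
      ↔ (∀ z ∈ ((expand ℝ 2 (∑ k ∈ Finset.range (m + 3), C (if Even k then lh k else uh k) * X ^ k)
              + Polynomial.X * expand ℝ 2 (∑ k ∈ Finset.range (m + 2), C (if Even k then lg k else ug k) * X ^ k)).map (algebraMap ℝ ℂ)).roots, z.re < 0)
        ∧ (∀ z ∈ ((expand ℝ 2 (∑ k ∈ Finset.range (m + 3), C (if Even k then lh k else uh k) * X ^ k)
              + Polynomial.X * expand ℝ 2 (∑ k ∈ Finset.range (m + 2), C (if Even k then ug k else lg k) * X ^ k)).map (algebraMap ℝ ℂ)).roots, z.re < 0)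
        ∧ (∀ z ∈ ((expand ℝ 2 (∑ k ∈ Finset.range (m + 3), C (if Even k then uh k else lh k) * X ^ k)
              + Polynomial.X * expand ℝ 2 (∑ k ∈ Finset.range (m + 2), C (if Even k then lg k else ug k) * X ^ k)).map (algebraMap ℝ ℂ)).roots, z.re < 0)
        ∧ (∀ z ∈ ((expand ℝ 2 (∑ k ∈ Finset.range (m + 3), C (if Even k then uh k else lh k) * X ^ k)
              + Polynomial.X * expand ℝ 2 (∑ k ∈ Finset.range (m + 2), C (if Even k then ug k else lg k) * X ^ k)).map (algebraMap ℝ ℂ)).roots, z.re < 0) := by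
  have hbh := envelope_mem_box hlhu
  have hbg := envelope_mem_box hlgu
  constructor
  · intro H
    exact ⟨H _ _ (natDegree_sum_C_mul_X_pow_le _ _) (natDegree_sum_C_mul_X_pow_le _ _) hbh.1 hbg.1,
      H _ _ (natDegree_sum_C_mul_X_pow_le _ _) (natDegree_sum_C_mul_X_pow_le _ _) hbh.1 hbg.2,
      H _ _ (natDegree_sum_C_mul_X_pow_le _ _) (natDegree_sum_C_mul_X_pow_le _ _) hbh.2 hbg.1,
      H _ _ (natDegree_sum_C_mul_X_pow_le _ _) (natDegree_sum_C_mul_X_pow_le _ _) hbh.2 hbg.2⟩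
  · rintro ⟨K1, K3, K4, K2⟩ h g hhd hgd hhb hgb
    -- the envelopes of `h` have degree `m + 2` and positive leading coefficient
    have htop' : 0 < uh (m + 2) := htop.trans_le (hlhu _ le_rfl)
    have hcm : (if Even (m + 2) then lh (m + 2) else uh (m + 2)) ≠ 0 := by split_ifs <;> positivity
    have hcM : (if Even (m + 2) then uh (m + 2) else lh (m + 2)) ≠ 0 := by split_ifs <;> positivity
    have hmlc : 0 < (∑ k ∈ Finset.range (m + 3), C (if Even k then lh k else uh k) * X ^ k : ℝ[X]).leadingCoeff := by
      rw [leadingCoeff_sum_C_mul_X_pow (c := fun k => if Even k then lh k else uh k) hcm]; split_ifs <;> assumption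
    have hMlc : 0 < (∑ k ∈ Finset.range (m + 3), C (if Even k then uh k else lh k) * X ^ k : ℝ[X]).leadingCoeff := by
      rw [leadingCoeff_sum_C_mul_X_pow (c := fun k => if Even k then uh k else lh k) hcM]; split_ifs <;> assumption
    -- the member `h` has degree `m + 2` and positive leading coefficient
    have hcoef : 0 < h.coeff (m + 2) := htop.trans_le (hhb _ le_rfl).1
    have hh : h.natDegree = m + 2 := le_antisymm hhd (le_natDegree_of_ne_zero hcoef.ne')
    have hlc : 0 < h.leadingCoeff := by rw [leadingCoeff, hh]; exact hcoef
    exact kharitonov_envelope_of_even m (natDegree_sum_C_mul_X_pow (c := fun k => if Even k then lh k else uh k) hcm) hmlc (natDegree_sum_C_mul_X_pow (c := fun k => if Even k then uh k else lh k) hcM) hMlc (natDegree_sum_C_mul_X_pow_le _ _)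
      (natDegree_sum_C_mul_X_pow_le _ _) K1 K3 K4 K2 hh hlc hgd (fun x hx => envelope_eval_le hhd hhb hx) (fun x hx => envelope_eval_le hgd hgb hx)

/-- **KHARITONOV'S THEOREM, ODD DEGREE `n = 2m + 3 ≥ 3`.**  For coefficient boxes `lh_k ≤ h_k ≤ uh_k` and `lg_k ≤ g_k ≤ ug_k` (`k ≤ m + 1`, `0 < lg_{m+1}`): every `p = h(X²) + X·g(X²)` of the
family is Hurwitz iff the four Kharitonov pairs are Hurwitz. [Kharitonov 1978, Thm; Bhattacharyya–Chapellat–Keel Thm 5.1; this file, §1021] -/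
theorem kharitonov_of_odd (m : ℕ) {lh uh lg ug : ℕ → ℝ} (hlhu : ∀ k, k ≤ m + 1 → lh k ≤ uh k) (hlgu : ∀ k, k ≤ m + 1 → lg k ≤ ug k) (htop : 0 < lg (m + 1)) :
    (∀ h g : ℝ[X], h.natDegree ≤ m + 1 → g.natDegree ≤ m + 1 → (∀ k, k ≤ m + 1 → lh k ≤ h.coeff k ∧ h.coeff k ≤ uh k) → (∀ k, k ≤ m + 1 → lg k ≤ g.coeff k ∧ g.coeff k ≤ ug k) →
        ∀ z ∈ ((expand ℝ 2 h + Polynomial.X * expand ℝ 2 g).map (algebraMap ℝ ℂ)).roots, z.re < 0)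
      ↔ (∀ z ∈ ((expand ℝ 2 (∑ k ∈ Finset.range (m + 2), C (if Even k then lh k else uh k) * X ^ k)
              + Polynomial.X * expand ℝ 2 (∑ k ∈ Finset.range (m + 2), C (if Even k then lg k else ug k) * X ^ k)).map (algebraMap ℝ ℂ)).roots, z.re < 0)
        ∧ (∀ z ∈ ((expand ℝ 2 (∑ k ∈ Finset.range (m + 2), C (if Even k then lh k else uh k) * X ^ k)
              + Polynomial.X * expand ℝ 2 (∑ k ∈ Finset.range (m + 2), C (if Even k then ug k else lg k) * X ^ k)).map (algebraMap ℝ ℂ)).roots, z.re < 0)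
        ∧ (∀ z ∈ ((expand ℝ 2 (∑ k ∈ Finset.range (m + 2), C (if Even k then uh k else lh k) * X ^ k)
              + Polynomial.X * expand ℝ 2 (∑ k ∈ Finset.range (m + 2), C (if Even k then lg k else ug k) * X ^ k)).map (algebraMap ℝ ℂ)).roots, z.re < 0)
        ∧ (∀ z ∈ ((expand ℝ 2 (∑ k ∈ Finset.range (m + 2), C (if Even k then uh k else lh k) * X ^ k)
              + Polynomial.X * expand ℝ 2 (∑ k ∈ Finset.range (m + 2), C (if Even k then ug k else lg k) * X ^ k)).map (algebraMap ℝ ℂ)).roots, z.re < 0) := by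
  have hbh := envelope_mem_box hlhu
  have hbg := envelope_mem_box hlgu
  constructor
  · intro H
    exact ⟨H _ _ (natDegree_sum_C_mul_X_pow_le _ _) (natDegree_sum_C_mul_X_pow_le _ _) hbh.1 hbg.1,
      H _ _ (natDegree_sum_C_mul_X_pow_le _ _) (natDegree_sum_C_mul_X_pow_le _ _) hbh.1 hbg.2,
      H _ _ (natDegree_sum_C_mul_X_pow_le _ _) (natDegree_sum_C_mul_X_pow_le _ _) hbh.2 hbg.1,
      H _ _ (natDegree_sum_C_mul_X_pow_le _ _) (natDegree_sum_C_mul_X_pow_le _ _) hbh.2 hbg.2⟩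
  · rintro ⟨K1, K3, K4, K2⟩ h g hhd hgd hhb hgb
    -- all four envelopes have degree `m + 1` and positive leading coefficient: the `h`-envelopes because `(envelope, g⁻)` Hurwitz forces positive coefficients
    have htop' : 0 < ug (m + 1) := htop.trans_le (hlgu _ le_rfl)
    have hcgm : (if Even (m + 1) then lg (m + 1) else ug (m + 1)) ≠ 0 := by split_ifs <;> positivity
    have hcgM : (if Even (m + 1) then ug (m + 1) else lg (m + 1)) ≠ 0 := by split_ifs <;> positivity
    have hgmlc : 0 < (∑ k ∈ Finset.range (m + 2), C (if Even k then lg k else ug k) * X ^ k : ℝ[X]).leadingCoeff := by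
      rw [leadingCoeff_sum_C_mul_X_pow (c := fun k => if Even k then lg k else ug k) hcgm]; split_ifs <;> assumption
    have hgMlc : 0 < (∑ k ∈ Finset.range (m + 2), C (if Even k then ug k else lg k) * X ^ k : ℝ[X]).leadingCoeff := by
      rw [leadingCoeff_sum_C_mul_X_pow (c := fun k => if Even k then ug k else lg k) hcgM]; split_ifs <;> assumption
    have hgm := natDegree_sum_C_mul_X_pow (c := fun k => if Even k then lg k else ug k) hcgm
    have hgM := natDegree_sum_C_mul_X_pow (c := fun k => if Even k then ug k else lg k) hcgM
    -- the coefficient `h_{m+1}` of a Hurwitz member is positive: read it off the Kharitonov pairs `K1` (lower `h`-envelope) and `K4` (upper `h`-envelope)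
    have hposm : 0 < (if Even (m + 1) then lh (m + 1) else uh (m + 1)) := by
      have hc := coeff_pos_of_forall_re_neg (p := expand ℝ 2 (∑ k ∈ Finset.range (m + 2), C (if Even k then lh k else uh k) * X ^ k)
        + Polynomial.X * expand ℝ 2 (∑ k ∈ Finset.range (m + 2), C (if Even k then lg k else ug k) * X ^ k))
        (by rw [leadingCoeff_even_add_odd_of_odd (leadingCoeff_ne_zero.1 hgmlc.ne') (by rw [hgm]; exact natDegree_sum_C_mul_X_pow_le _ _)]; exact hgmlc) K1 (2 * (m + 1))
        (by rw [natDegree_even_add_odd_of_le_right (leadingCoeff_ne_zero.1 hgmlc.ne') (by rw [hgm]; exact natDegree_sum_C_mul_X_pow_le _ _), hgm]; omega)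
      rwa [coeff_even_eq, coeff_sum_C_mul_X_pow (fun k => if Even k then lh k else uh k), if_pos le_rfl] at hc
    have hposM : 0 < (if Even (m + 1) then uh (m + 1) else lh (m + 1)) := by
      have hc := coeff_pos_of_forall_re_neg (p := expand ℝ 2 (∑ k ∈ Finset.range (m + 2), C (if Even k then uh k else lh k) * X ^ k)
        + Polynomial.X * expand ℝ 2 (∑ k ∈ Finset.range (m + 2), C (if Even k then lg k else ug k) * X ^ k))
        (by rw [leadingCoeff_even_add_odd_of_odd (leadingCoeff_ne_zero.1 hgmlc.ne') (by rw [hgm]; exact natDegree_sum_C_mul_X_pow_le _ _)]; exact hgmlc) K4 (2 * (m + 1))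
        (by rw [natDegree_even_add_odd_of_le_right (leadingCoeff_ne_zero.1 hgmlc.ne') (by rw [hgm]; exact natDegree_sum_C_mul_X_pow_le _ _), hgm]; omega)
      rwa [coeff_even_eq, coeff_sum_C_mul_X_pow (fun k => if Even k then uh k else lh k), if_pos le_rfl] at hc
    have hhm := natDegree_sum_C_mul_X_pow (c := fun k => if Even k then lh k else uh k) hposm.ne'
    have hhM := natDegree_sum_C_mul_X_pow (c := fun k => if Even k then uh k else lh k) hposM.ne'
    have hmlc : 0 < (∑ k ∈ Finset.range (m + 2), C (if Even k then lh k else uh k) * X ^ k : ℝ[X]).leadingCoeff := by rw [leadingCoeff_sum_C_mul_X_pow (c := fun k => if Even k then lh k else uh k) hposm.ne']; exact hposm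
    have hMlc : 0 < (∑ k ∈ Finset.range (m + 2), C (if Even k then uh k else lh k) * X ^ k : ℝ[X]).leadingCoeff := by rw [leadingCoeff_sum_C_mul_X_pow (c := fun k => if Even k then uh k else lh k) hposM.ne']; exact hposM
    -- the member `g` has degree `m + 1` and positive leading coefficient
    have hcoef : 0 < g.coeff (m + 1) := htop.trans_le (hgb _ le_rfl).1
    have hg : g.natDegree = m + 1 := le_antisymm hgd (le_natDegree_of_ne_zero hcoef.ne')
    have hglc : 0 < g.leadingCoeff := by rw [leadingCoeff, hg]; exact hcoef
    exact kharitonov_envelope_of_odd m hhm hmlc hhM hMlc hgm hgM K1 K3 K4 K2 hhd hg hglc (fun x hx => envelope_eval_le hhd hhb hx) (fun x hx => envelope_eval_le hgd hgb hx)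

end Summit.Ventures.HSemireg.Wedge.HankelOuter
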